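import Literature.NumberTheory.GaloisRepresentations.FrobeniusQuotientHOne
import Literature.NumberTheory.GaloisRepresentations.HochschildSerreLowDegree
import Literature.NumberTheory.GaloisRepresentations.LocalFieldCdTwo
import Literature.NumberTheory.GaloisRepresentations.ContinuousCohomologyConnecting
import HarnessLib

/-!
# A cocycle with values in `π(A^{I})`, vanishing on inertia, is `π_*` of a class of `H¹(F, A)`
# (finite discrete coefficients over a non-archimedean local field) — file U4 of the proposed row
# T-DER-BU (cell `b2b-bsdres`, team n1011, seat p15 GEN 27 — custodian by-product, OFFERED)

HONEST FRAMING (cell `b2b-bsdres`, run/shared/lean/b2b/bsd-rank1-residual/, verbatim in every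
file): the goal of the cell is to DELETE the COMBINATION-SHAPED residual classes of the
Birch–Swinnerton-Dyer formula for ALL analytic-rank `≤ 1` elliptic curves over `ℚ` — "full BSD
formula for every rank `≤ 1` curve in class `C`" assembled STRICTLY from published theorems — so
that the rank-`≤ 1` remainder becomes exactly the CONSTRUCTION-SHAPED classes, which are TYPED
(missing-input `Prop`s), NOT attempted. This is not "finishing BSD". Team n1011 (N10 / N11, the
additive block X4 ∧ `p = 3`): research route on the CONSTRUCTION-SHAPED class X4; no claim beyond the
stated classes; nothing is booked. TOOL theorems of local Galois cohomology (no definition, no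
named fact, no `sorry`); curve-free and `p`-free.

## What

`F` a non-archimedean local field, `N = Gal(F̄/F^nr)` (`galUnr F`) its inertia group, `φ` an
arithmetic Frobenius (`IsFrobPow φ 1`).
§1 `eq_top_of_isOpen_of_galUnr_le` — an OPEN subgroup of `Γ_F` containing `N` and `φ` is all of
`Γ_F` (Frobenius generates `Γ_F` modulo `N` and any open normal subgroup: `exists_pow_eq_mk_quotient`).
§2 `contOneCocycles.eq_zero_of_galUnr_of_frob` — a continuous cocycle with DISCRETE values vanishing
on `N` and at `φ` vanishes (its zero set is an open subgroup).
§3 **`exists_map_eq_oneCocycleClass_of_apply_eq_hom_invariant`** — for discrete modules `A` (finite),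
`A′` of `Γ_F`, an equivariant `π : A ⟶ A′`, and a cocycle `k : Γ_F → A′` VANISHING ON `N` whose every
value is `π(t)` for some `t ∈ A^N`: **`[k] = π_* z` for some `z ∈ H¹(Γ_F, A)`** (indeed `z` inflated
from `H¹(Γ_F/N, A^N)`).  Proof: evaluation at `φ` is a bijection `H¹(Γ_F/N, A^N) → A^N/(φ−1)A^N`
(injective by `contOneCocycles.eq_zero_of_apply_eq_zero`; same cardinality by
`natCard_continuousCohomology_one_quotient_galUnr` and `#ker(φ−1) = #coker(φ−1)`), so some inflated
class `z` has `z(φ) ≡ t_φ`; then `π_* z − [k]` is represented by a cocycle vanishing on `N` and,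
after a coboundary, at `φ` — hence zero by §2.

WHY (design `HOME/b2b-bsdres-n1011-p15/g27/T-DER-BU-SCOPING.md` §3 (3)): file U2
(`exists_rep_sub_coboundary_eq_red_invariant`) shows that Kolyvagin's class at a bad place `w` is
represented, up to a coboundary, by a cocycle vanishing on `I_w` with values in `π(T^{I_w})`; at finite
coefficients `A = E[p^j]` this file turns that into membership in `im(H¹(ℚ_w, E[p^j]) → H¹(ℚ_w, E[p^{k+1}]))`,
which is `𝓕_can` in the stable range ([MR04] Prop. A.2; tree `PropagatedConditionStableRange`).

References: J.-P. Serre, *Local Fields* (1979), XIII §1; J. S. Milne, *Arithmetic Duality Theorems*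
(2006), I §2 (Lemma 2.9); B. Mazur, K. Rubin, *Kolyvagin systems* (2004), App. A Remark A.5.
-/

noncomputable section

open scoped Pointwise
open CategoryTheory Function
open Field IsNonarchimedeanLocalField ValuativeRel

universe u v

namespace Summit.BirchSwinnertonDyer.Rank1Residual.GaloisImage

namespace Derivative

open Literature.NumberTheory.GaloisRepresentations
open Literature.NumberTheory.GaloisRepresentations.IsNonarchimedeanLocalField
open _root_.TopRep _root_.ContRepresentation _root_.ContinuousCohomology DiscreteGaloisModule

section Local

variable (F : Type u) [Field F] [ValuativeRel F] [TopologicalSpace F] [IsNonarchimedeanLocalField F]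

/-- **An open subgroup of `Γ_F` containing the inertia group `Gal(F̄/F^nr)` and an arithmetic
Frobenius is everything**: every coset of `Γ_F` modulo `N` and an open normal subgroup is a power of
the Frobenius (`exists_pow_eq_mk_quotient`). [cite: SerreLocalFields1979, XIII §1] -/
theorem eq_top_of_isOpen_of_galUnr_le (S : Subgroup (absoluteGaloisGroup F))
    (hS : IsOpen (S : Set (absoluteGaloisGroup F))) (hNS : galUnr F ≤ S)
    {φ : absoluteGaloisGroup F} (hφ : IsFrobPow φ 1) (hφS : φ ∈ S) : S = ⊤ := by
  classical
  haveI := absoluteGaloisGroup_compactSpace F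
  obtain ⟨U₀, hU₀⟩ := ProfiniteGrp.exist_openNormalSubgroup_sub_open_nhds_of_one hS S.one_mem
  let H : Subgroup (absoluteGaloisGroup F ⧸ galUnr F) :=
    (U₀ : Subgroup (absoluteGaloisGroup F)).map (QuotientGroup.mk' (galUnr F))
  haveI : H.Normal := Subgroup.Normal.map inferInstance _ (QuotientGroup.mk'_surjective _)
  have hHo : IsOpen (H : Set (absoluteGaloisGroup F ⧸ galUnr F)) := by
    change IsOpen ((QuotientGroup.mk' (galUnr F)) ''
      ((U₀ : Subgroup (absoluteGaloisGroup F)) : Set (absoluteGaloisGroup F)))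
    exact QuotientGroup.isOpenMap_coe
      ((U₀ : Subgroup (absoluteGaloisGroup F)) : Set (absoluteGaloisGroup F)) U₀.isOpen
  rw [eq_top_iff]
  intro g _
  obtain ⟨i, hi⟩ := exists_pow_eq_mk_quotient F H hHo hφ
    (QuotientGroup.mk (QuotientGroup.mk g : absoluteGaloisGroup F ⧸ galUnr F))
  rw [← QuotientGroup.mk_pow, ← QuotientGroup.mk_pow, QuotientGroup.eq, ← QuotientGroup.mk_inv,
    ← QuotientGroup.mk_mul] at hi
  obtain ⟨u, hu, hu'⟩ := Subgroup.mem_map.mp hi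
  rw [QuotientGroup.mk'_apply, QuotientGroup.eq] at hu'
  have h1 : u⁻¹ * (g⁻¹ * φ ^ i) ∈ S := hNS hu'
  have h2 : u ∈ S := hU₀ hu
  have h3 : φ ^ i ∈ S := S.pow_mem hφS i
  have e : g = φ ^ i * (u⁻¹ * (g⁻¹ * φ ^ i))⁻¹ * u⁻¹ := by group
  rw [e]
  exact S.mul_mem (S.mul_mem h3 (S.inv_mem h1)) (S.inv_mem h2)

variable {F}

/-- **A continuous cocycle with discrete values that vanishes on the inertia group and at an
arithmetic Frobenius vanishes identically** (its zero set is an open subgroup containing both).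
[cite: SerreLocalFields1979, XIII §1] -/
theorem contOneCocycles.eq_zero_of_galUnr_of_frob {R : Type v} [CommRing R] [TopologicalSpace R]
    (X : TopRep.{u} R (absoluteGaloisGroup F)) [DiscreteTopology X] (e : contOneCocycles X)
    (hN : ∀ u ∈ galUnr F, e.1 u = 0) {φ : absoluteGaloisGroup F} (hφ : IsFrobPow φ 1)
    (he : e.1 φ = 0) : e = 0 := by
  let S : Subgroup (absoluteGaloisGroup F) :=
    { carrier := {g | e.1 g = 0}
      one_mem' := contOneCocycles.apply_one e
      mul_mem' := fun {a b} ha hb => by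
        change e.1 (a * b) = 0
        change e.1 a = 0 at ha
        change e.1 b = 0 at hb
        rw [e.2 a b, ha, hb, map_zero, add_zero]
      inv_mem' := fun {a} ha => by
        change e.1 a⁻¹ = 0
        change e.1 a = 0 at ha
        have h := e.2 a⁻¹ a
        rw [inv_mul_cancel, contOneCocycles.apply_one, ha, map_zero, add_zero] at h
        exact h.symm }
  have hS : IsOpen (S : Set (absoluteGaloisGroup F)) := by
    change IsOpen (e.1 ⁻¹' {0})
    exact (isOpen_discrete {(0 : X)}).preimage e.1.continuous
  have htop := eq_top_of_isOpen_of_galUnr_le F S hS (fun u hu => hN u hu) hφ he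
  refine Subtype.ext (ContinuousMap.ext fun g => ?_)
  have hg : g ∈ S := by rw [htop]; exact Subgroup.mem_top g
  exact hg

set_option maxHeartbeats 400000 in
/-- **The unramified lift** (module docstring, §3).  For a finite discrete `Γ_F`-module `A`, a
discrete `A′`, an equivariant `π : A ⟶ A′` and a continuous cocycle `k : Γ_F → A′` vanishing on the
inertia group `N` with `k(g) ∈ π(A^N)` for every `g`: `[k] = π_* z` for some `z ∈ H¹(Γ_F, A)`.
(Evaluation at Frobenius `H¹(Γ_F/N, A^N) ≅ A^N/(φ−1)A^N` — `h¹ = h⁰` over `Ẑ` — and §2.)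
[cite: SerreLocalFields1979, XIII §1 Prop. 1] [cite: MilneADT2006, I §2 Lemma 2.9]
[cite: MazurRubin2004, App. A Remark A.5 (p. 81)] -/
theorem exists_map_eq_oneCocycleClass_of_apply_eq_hom_invariant
    {A A' : Type u} [AddCommGroup A] [TopologicalSpace A] [DiscreteTopology A] [Finite A]
    [AddCommGroup A'] [TopologicalSpace A'] [DiscreteTopology A']
    (ρ : DiscreteGaloisModule F A) (ρ' : DiscreteGaloisModule F A') (π : ρ.toTopRep ⟶ ρ'.toTopRep)
    (k : contOneCocycles ρ'.toTopRep) (hkN : ∀ u ∈ galUnr F, k.1 u = 0)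
    (hk : ∀ g, ∃ t : A, (∀ u ∈ galUnr F, ρ u t = t) ∧ k.1 g = π.hom t) :
    ∃ z : continuousCohomology 1 ρ.toTopRep, cohomologyMap π 1 z = oneCocycleClass _ k := by
  classical
  haveI := absoluteGaloisGroup_compactSpace F
  set N : Subgroup (absoluteGaloisGroup F) := galUnr F with hNdef
  set Q := absoluteGaloisGroup F ⧸ N
  -- an arithmetic Frobenius
  obtain ⟨φ, hφ⟩ := exists_isFrobPow_holds (F := F) 1
  set φQ : Q := QuotientGroup.mk φ with hφQ
  have hgen : ∀ (H : Subgroup Q) [H.Normal], IsOpen (H : Set Q) →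
      ∀ r : Q ⧸ H, ∃ i : ℕ, r = (QuotientGroup.mk φQ : Q ⧸ H) ^ i :=
    fun H _ hH r => exists_pow_eq_mk_quotient F H hH hφ r
  -- the `Q`-module `B = A^N`
  set τ := ρ.quotientInvariants N with hτdef
  let T : τ.toTopRep →ₗ[ℤ] τ.toTopRep := τ φQ
  let δ : τ.toTopRep →+ τ.toTopRep := (T - 1 : τ.toTopRep →ₗ[ℤ] τ.toTopRep).toAddMonoidHom
  have hδ : ∀ b, δ b = T b - b := fun _ => rfl
  -- an open normal subgroup of `Q` acting trivially
  obtain ⟨H₀, hH₀n, hH₀o, hH₀X, -⟩ := exists_open_normal_invariant F τ 0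
  haveI := hH₀n
  haveI : Finite (Q ⧸ H₀) := Subgroup.quotient_finite_of_isOpen H₀ hH₀o
  -- (1) invariants `= ker δ`
  have hinv : ∀ b : τ.toTopRep, (∀ q : Q, τ q b = b) ↔ δ b = 0 := fun b => by
    refine ⟨fun h => by rw [hδ, sub_eq_zero]; exact h φQ, fun h q => ?_⟩
    rw [hδ, sub_eq_zero] at h
    have hpow : ∀ i : ℕ, τ (φQ ^ i) b = b := fun i => by
      induction i with
      | zero => rw [pow_zero, map_one, Module.End.one_apply]
      | succ i ih => rw [pow_succ, map_mul, Module.End.mul_apply, h, ih]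
    obtain ⟨i, hi⟩ := hgen H₀ hH₀o (QuotientGroup.mk q)
    rw [← QuotientGroup.mk_pow, QuotientGroup.eq] at hi
    rw [show q = φQ ^ i * (q⁻¹ * φQ ^ i)⁻¹ by rw [mul_inv_rev, inv_inv, mul_inv_cancel_left], map_mul,
      Module.End.mul_apply, hH₀X _ (H₀.inv_mem hi), hpow]
  have e_inv : τ.toTopRep.ρ.invariants ≃ δ.ker :=
    { toFun := fun v => ⟨v.1, (hinv v.1).1 fun q => v.2 q⟩
      invFun := fun v => ⟨v.1, fun q => (hinv v.1).2 v.2 q⟩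
      left_inv := fun _ => rfl
      right_inv := fun _ => rfl }
  -- (2) `#(B / im δ) = #ker δ`
  have hcount : Nat.card (τ.toTopRep ⧸ δ.range) = Nat.card δ.ker := by
    have h1 := AddSubgroup.card_eq_card_quotient_mul_card_addSubgroup δ.range
    have h2 := AddSubgroup.card_eq_card_quotient_mul_card_addSubgroup δ.ker
    rw [Nat.card_congr (QuotientAddGroup.quotientKerEquivRange δ).toEquiv] at h2
    have hpos : 0 < Nat.card δ.range := Nat.card_pos
    rw [h2, mul_comm] at h1
    exact (Nat.eq_of_mul_eq_mul_right hpos h1).symm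
  -- (3) evaluation at `φ`: `H¹(Q, B) → B / im δ` is injective, hence bijective by counting
  choose rep hrep using fun c : continuousCohomology 1 τ.toTopRep => oneCocycleClass_surjective _ c
  let f : continuousCohomology 1 τ.toTopRep → τ.toTopRep ⧸ δ.range :=
    fun c => QuotientAddGroup.mk ((rep c).1 φQ)
  have hfinj : Injective f := by
    intro c d hcd
    obtain ⟨b₁, hb₁⟩ : -((rep c).1 φQ) + (rep d).1 φQ ∈ δ.range := (QuotientAddGroup.eq).1 hcd
    set w : contOneCocycles τ.toTopRep := rep d - rep c - coboundaryCocycle τ b₁ with hwdef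
    obtain ⟨H, hHn, hHo, -, hHw⟩ := exists_open_normal_invariant F τ w
    haveI := hHn
    have hw0 : w = 0 := by
      refine contOneCocycles.eq_zero_of_apply_eq_zero φQ H (hgen H hHo) w hHw ?_
      change (rep d).1 φQ - (rep c).1 φQ - (τ φQ b₁ - b₁) = 0
      rw [← hδ, hb₁]; abel
    have : oneCocycleClass _ (rep d) - oneCocycleClass _ (rep c) = 0 := by
      rw [← oneCocycleClass_sub, show rep d - rep c = w + coboundaryCocycle τ b₁ by rw [hwdef]; abel,
        hw0, zero_add, oneCocycleClass_coboundaryCocycle]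
    rw [hrep, hrep, sub_eq_zero] at this
    exact this.symm
  have hcard : Nat.card (τ.toTopRep ⧸ δ.range) ≤ Nat.card (continuousCohomology 1 τ.toTopRep) := by
    rw [natCard_continuousCohomology_one_quotient_galUnr F _ τ, hcount, Nat.card_congr e_inv]
  have hfsurj : Surjective f := (hfinj.bijective_of_nat_card_le hcard).2
  -- (4) the value at `φ`: `k φ = π t₀`, `t₀ ∈ A^N`
  obtain ⟨t₀, ht₀N, hkφ⟩ := hk φ
  let b₀ : τ.toTopRep := ⟨t₀, fun n => ht₀N n n.2⟩
  obtain ⟨c, hc⟩ := hfsurj (QuotientAddGroup.mk b₀)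
  -- `(rep c) φ = b₀ + δ b` for some `b`
  obtain ⟨b, hb⟩ : -((rep c).1 φQ) + b₀ ∈ δ.range := (QuotientAddGroup.eq).1 hc
  -- (5) the inflated class `z`
  refine ⟨infOne N ρ c, ?_⟩
  rw [← hrep c]
  have hinf : cohomologyMap π 1 (infOne N ρ (oneCocycleClass τ.toTopRep (rep c))) =
      oneCocycleClass ρ'.toTopRep (contOneCocycles.pullback (ContinuousMonoidHom.id _) (resIdHom π)
        (contOneCocycles.pullback (ContinuousMonoidHom.quotientMk N) (invariantsIncl N ρ) (rep c))) := by
    have h1 := map_oneCocycleClass _ (ContinuousMonoidHom.quotientMk N) (invariantsIncl N ρ) (rep c)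
    have h2 := cohomologyMap_oneCocycleClass π
      (contOneCocycles.pullback (ContinuousMonoidHom.quotientMk N) (invariantsIncl N ρ) (rep c))
    exact (congrArg (fun x => cohomologyMap π 1 x) h1).trans h2
  rw [hinf, ← sub_eq_zero, ← oneCocycleClass_sub]
  -- the difference is the coboundary of `-π b`
  set w : contOneCocycles ρ'.toTopRep :=
    contOneCocycles.pullback (ContinuousMonoidHom.id _) (resIdHom π)
        (contOneCocycles.pullback (ContinuousMonoidHom.quotientMk N) (invariantsIncl N ρ) (rep c)) - k
    with hwdef
  have hwN : ∀ u ∈ galUnr F, w.1 u = 0 := by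
    intro u hu
    have hu1 : (QuotientGroup.mk u : Q) = 1 := (QuotientGroup.eq_one_iff u).mpr hu
    change π.hom (((rep c).1 (QuotientGroup.mk u : Q) : ρ.toTopRep)) - k.1 u = 0
    rw [hu1, contOneCocycles.apply_one, hkN u hu]
    change π.hom (0 : ρ.toTopRep) - 0 = 0
    rw [map_zero, sub_zero]
  have hwφ : w.1 φ = -(ρ'.toTopRep.ρ φ (π.hom (b : A)) - π.hom (b : A)) := by
    change π.hom (((rep c).1 φQ : ρ.toTopRep)) - k.1 φ = _
    have h1 : ((rep c).1 φQ : τ.toTopRep) = b₀ - δ b := by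
      rw [hb]; abel
    rw [h1, hkφ, hδ]
    change π.hom ((t₀ : A) - ((ρ φ (b : A)) - (b : A))) - π.hom t₀ = _
    rw [map_sub, map_sub, ← TopRep.hom_comm_apply π φ (b : A), ContinuousRep.toTopRep_ρ_apply]
    abel
  -- `w + ∂(π b)` vanishes on `N` and at `φ`, hence is zero
  set e : contOneCocycles ρ'.toTopRep := w + coboundaryCocycle ρ' (π.hom (b : A)) with hedef
  have heN : ∀ u ∈ galUnr F, e.1 u = 0 := by
    intro u hu
    change w.1 u + (ρ' u (π.hom (b : A)) - π.hom (b : A)) = 0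
    rw [hwN u hu, zero_add, sub_eq_zero, ← ContinuousRep.toTopRep_ρ_apply, ← TopRep.hom_comm_apply π u (b : A),
      ContinuousRep.toTopRep_ρ_apply]
    exact congrArg π.hom (b.2 ⟨u, hu⟩)
  have heφ : e.1 φ = 0 := by
    change w.1 φ + (ρ' φ (π.hom (b : A)) - π.hom (b : A)) = 0
    rw [hwφ, ContinuousRep.toTopRep_ρ_apply]
    abel
  haveI : DiscreteTopology ρ'.toTopRep := inferInstanceAs (DiscreteTopology A')
  have he0 : e = 0 :=
    contOneCocycles.eq_zero_of_galUnr_of_frob (X := ρ'.toTopRep) e heN hφ heφ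
  have hw : w = -coboundaryCocycle ρ' (π.hom (b : A)) := by
    rw [← add_eq_zero_iff_eq_neg, ← hedef, he0]
  rw [hw]
  have hneg : oneCocycleClass ρ'.toTopRep (-coboundaryCocycle ρ' (π.hom (b : A))) =
      -oneCocycleClass ρ'.toTopRep (coboundaryCocycle ρ' (π.hom (b : A))) := by
    rw [← oneCocycleClassₗ_apply, map_neg, oneCocycleClassₗ_apply]
  rw [hneg, oneCocycleClass_coboundaryCocycle, neg_zero]

end Local

end Derivative

end Summit.BirchSwinnertonDyer.Rank1Residual.GaloisImage

end
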